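import Literature.NumberTheory.EllipticCurves.Selmer
import Literature.NumberTheory.EllipticCurves.FaulknerJames2007.RhoIndexEvenPartitionBound
import Literature.NumberTheory.EllipticCurves.TwoDescentKummerBridge
import Literature.NumberTheory.EllipticCurves.PointDivisibilityProofs
import HarnessLib

/-!
# Tian–Yuan–Zhang's `ρ(n)` and the torsion classes `{1, [−1], [n], [−n]}` (file 1 of 3)

For `n ≠ 0` let `E_n : y² = x³ − n²x` (`congruentNumberCurve n`), `A_n : 2nv² = u³ + u`, `φ_n : A_n → E_n` the
`2`-isogeny of Tian–Yuan–Zhang, Asian J. Math. 21 (2017), §1, and `2^{ρ(n)} := [E_n(ℚ) : φ_n(A_n(ℚ)) + E_n[2]]`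
(tree: `(TianYuanZhang2017.rhoSubgroup n).index`, the integer of the printed Theorem 1.2/1.4
"`2^{−ρ(n)}𝓛(n)` is even only if the genus sums are even", tree fact `thm12_parity_of_scriptL'`).

Let `α : E_n(ℚ) → ℚ^×/ℚ^{×2}` be the `x`-coordinate class (`(0,0) ↦ [−n²] = [−1]`, `O ↦ 1`): the `2`-descent
component for the root `0` of the roots `(0, −n, n)` (tree `twoDescentComponent`, `descentRep`), whose kernel is
`φ_n(A_n(ℚ)) ∪ {O}` (Silverman X.4.9; tree `FaulknerJames2007.some_mem_isogenyImageTYZ_of_sq`) and with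
`α(E_n[2]) = {1, [−1], [n], [−n]}`. THIS FILE PROVES (theorems only; no named fact; nothing about BSD):

* `inTorsionClasses_descentRep_of_selmer` — if the `b`-component (= `x (mod ℚ^{×2})`) of EVERY class of the
  cohomological `Sel⁽²⁾(E_n/ℚ)` lies in `{1, [−1], [n], [−n]}`, so does `α(P)` for every rational point `P`
  (the Kummer class of `P` is a Selmer class with that component, tree `kummerEquiv_twoTorsionCharH1_kummerMapTorsion`);
* `rhoIndex_eq_one_of_forall_inTorsionClasses` — if `α(E_n(ℚ)) ⊆ {1, [−1], [n], [−n]}` then `ρ(n) = 0`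
  (translate by the `2`-torsion point with the same class; points with `α = 1` lie in `φ_n(A_n(ℚ))`);
* `sqClass_descentRep_of_mem_rhoSubgroup`, `rhoIndex_ne_one_of_witness` — conversely `α` maps
  `φ_n(A_n(ℚ)) + E_n[2]` into `{1, [−1], [n], [−n]}`, so ONE rational point `P` with
  `x(P) ∉ {1, −1, n, −n}·ℚ^{×2}` forces `ρ(n) ≥ 1`;
* `rhoIndex_ne_one_twentyOne` — `ρ(21) ≠ 0`, witnessed by `(−3, 36) ∈ E_21(ℚ)`. Since `s(21) = 1` and
  `Σ₁(21) = g(21)` is odd, `E_21` lies in the U⁺ family (`#Sel₂ = 8`, odd genus sum) of the cell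
  `bsd-print-cf2` but NOT in the flag-free `TYZρ` family (`ρ = 0` clause), and the typed Theorem 1.4
  (`2^{ρ+1} ∣ 𝓛 → genus sums even`) is silent about the parity of `𝓛(21)` — a concrete member of the residual of
  the crux `RamifiedOffTYZOfFacts` on which the flag-free bundle's only `2`-adic analytic input says nothing.

Files 2/3 (`RhoIndexMonskyKernelOdd/Even.lean`) feed the first theorem with Monsky's matrices: `ρ(n) = 0`
whenever every kernel vector of Monsky's matrix has the torsion shape — rank-free, certificate-free, for every
`n (mod 8)` (the Faulkner–James door of the tree needs `n ≡ ±1 (mod 8)` and a small Laplacian kernel).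
Cell `bsd-print-cf2`, seat p2 («2-descent matrix road»).

## References

* [TianYuanZhang2017] Y. Tian, X. Yuan, S.-W. Zhang, *Genus periods, genus points and congruent number problem*,
  Asian J. Math. 21 (2017) 721–774 = arXiv:1411.4728, §1 (definition of `ρ(n)`, chunk p0002 L101–L110),
  Thm. 1.2 (journal Thm. 1.4).
* [HeathBrown1994SelmerCongruentII] D. R. Heath-Brown, *The size of Selmer groups for the congruent number
  problem, II*, with an appendix by P. Monsky, Invent. Math. 118 (1994) 331–370: Appendix, typescript
  p. 38 L17 – p. 39 L33 (odd `D`), p. 40 L40 – p. 41 L36 (even `D`).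
* [SilvermanAEC2009] J. H. Silverman, *The Arithmetic of Elliptic Curves*, 2nd ed., GTM 106, Thm. X.1.1,
  Prop. X.1.4, Prop. X.4.9.
* [FaulknerJames2007] B. Faulkner, K. James, Ramanujan J. 14 (2007) 107–129, Thm. 1.2 (2) (the `φ̂`-side bound,
  tree `RhoIndexEvenPartitionBound.lean`, for comparison).
-/

noncomputable section

open scoped Classical

open WeierstrassCurve WeierstrassCurve.Affine WeierstrassCurve.Affine.Point
open Literature.NumberTheory.GaloisRepresentations
open Literature.NumberTheory.EllipticCurves.KramerTwoDescent
open Literature.NumberTheory.EllipticCurves.TwoDescentLocal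
open Literature.NumberTheory.EllipticCurves.TianYuanZhang2017
open Literature.NumberTheory.EllipticCurves.FaulknerJames2007
open IsDedekindDomain NumberField

namespace Literature.NumberTheory.EllipticCurves.TianYuanZhang2017

namespace RhoMonskyKernel

/-- In `ℚ^×/ℚ^{×2}` every class is its own inverse. [folklore] -/
private theorem sqUnits_inv_eq_self (u : SqUnits ℚ) : u⁻¹ = u := by
  rw [inv_eq_iff_mul_eq_one, SqUnits.mul_self]

/-! ### §0. The torsion classes `{1, [−1], [n], [−n]}` and the generic reduction to Selmer classes -/

/-- `E_n` has the rational `2`-torsion `0, −n, n` (in this order). [folklore] -/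
private theorem hsplit (n : ℕ) : (congruentNumberCurve n).toAffine.SplitTwoTorsion 0 (-(n : ℚ)) n :=
  (splitTwoTorsion_cn n).swap₁₂

/-- **From Selmer classes to rational points.** If the `b`-component (`x (mod ℚ^{×2})`, the `2`-descent
component for the root `0`) of every class of `Sel⁽²⁾(E_n/ℚ)` lies in `{1, [−1], [n], [−n]}`, then so does the
`x`-coordinate class of every rational point — its Kummer class is a Selmer class whose second component is
`x(P)` (Silverman X.1.4). [cite: SilvermanAEC2009, Thm. X.1.1, Prop. X.1.4] -/
theorem inTorsionClasses_descentRep_of_selmer {n : ℕ} (hn : n ≠ 0)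
    (hsel : haveI := isElliptic_congruentNumberCurve hn
      ∀ c ∈ (congruentNumberCurve n).selmerGroup 2, ∀ b : ℚˣ,
        kummerEquiv ℚ 2 ((congruentNumberCurve n).twoTorsionCharH1 (splitTwoTorsion_cn n).swap₁₂ c) =
          Additive.ofMul (QuotientGroup.mk b) → (sqClass (b : ℚ) = 1 ∨ sqClass (b : ℚ) = sqClass (-1 : ℚ) ∨ sqClass (b : ℚ) = sqClass (n : ℚ) ∨ sqClass (b : ℚ) = sqClass (-(n : ℚ))))
    (P : (congruentNumberCurve n).toAffine.Point) :
    (sqClass (descentRep 0 (-(n : ℚ)) n P) = 1 ∨ sqClass (descentRep 0 (-(n : ℚ)) n P) = sqClass (-1 : ℚ) ∨ sqClass (descentRep 0 (-(n : ℚ)) n P) = sqClass (n : ℚ) ∨ sqClass (descentRep 0 (-(n : ℚ)) n P) = sqClass (-(n : ℚ))) := by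
  haveI := isElliptic_congruentNumberCurve hn
  have hT := splitTwoTorsion_cn n
  have hdiv : ∀ Q : geomPoints (congruentNumberCurve n),
      ∃ R : geomPoints (congruentNumberCurve n), (2 : ℤ) • R = Q :=
    fun Q => (congruentNumberCurve n).zsmul_geomPoints_surjective_holds (n := 2) two_ne_zero Q
  have hmem : kummerMapTorsion (congruentNumberCurve n) 2 hdiv P ∈ (congruentNumberCurve n).selmerGroup 2 :=
    ((congruentNumberCurve n).mem_selmerGroup_iff _ _).mpr
      ⟨fun _ => kummerMapTorsion_mem_selmerLocalKer _ _ _ _ P,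
        fun _ => kummerMapTorsion_mem_selmerLocalKer _ _ _ _ P⟩
  have hrep := descentRep_ne_zero (hsplit n) P
  have hcomp : twoDescentComponent (congruentNumberCurve n).toAffine 0 (-(n : ℚ)) n P =
      QuotientGroup.mk (Units.mk0 _ hrep) := by
    rw [twoDescentComponent_eq_sqClass, sqClass_of_ne_zero hrep]
  have hb : kummerEquiv ℚ 2 ((congruentNumberCurve n).twoTorsionCharH1 hT.swap₁₂
      (kummerMapTorsion (congruentNumberCurve n) 2 hdiv P)) =
      Additive.ofMul (QuotientGroup.mk (Units.mk0 _ hrep)) := by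
    rw [(congruentNumberCurve n).kummerEquiv_twoTorsionCharH1_kummerMapTorsion hT.swap₁₂ hdiv P]
    congr 1
    convert hcomp using 2
  have := hsel _ hmem (Units.mk0 _ hrep) hb
  rwa [Units.val_mk0] at this

/-- A rational point of `E_n` whose `x`-coordinate class is trivial lies in `φ_n(A_n(ℚ)) ∪ {O} ⊆ rhoSubgroup n`
(the explicit section `FaulknerJames2007.some_mem_isogenyImageTYZ_of_sq`). [cite: SilvermanAEC2009, Prop. X.4.9]
[cite: TianYuanZhang2017, §1, definition of ρ(n)] -/
theorem mem_rhoSubgroup_of_sqClass_eq_one {n : ℕ} (hn : n ≠ 0) (P : (congruentNumberCurve n).toAffine.Point)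
    (h1 : sqClass (descentRep 0 (-(n : ℚ)) n P) = 1) : P ∈ rhoSubgroup n := by
  haveI := isElliptic_congruentNumberCurve hn
  have hn0 : (n : ℚ) ≠ 0 := Nat.cast_ne_zero.mpr hn
  rcases P with _ | ⟨x, y, hP⟩
  · exact AddSubgroup.zero_mem _
  · by_cases hx : x = 0
    · exfalso
      rw [descentRep_some_of_eq hP hx, sqClass_eq_one_iff (by
        rw [show ((0:ℚ) - -(n:ℚ)) * (0 - n) = -((n:ℚ) ^ 2) by ring]; exact neg_ne_zero.mpr (pow_ne_zero 2 hn0))] at h1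
      obtain ⟨u, hu⟩ := h1
      have : (0 : ℚ) < (n : ℚ) ^ 2 := by positivity
      nlinarith [sq_nonneg u]
    · rw [descentRep_some_of_ne hP hx, sub_zero, sqClass_eq_one_iff hx] at h1
      obtain ⟨w, hw⟩ := h1
      have hw0 : w ≠ 0 := by rintro rfl; exact hx (by rw [hw]; ring)
      exact AddSubgroup.subset_closure (Or.inl (some_mem_isogenyImageTYZ_of_sq hn hP hw0 hw))

/-- **`ρ(n) = 0` from the torsion classes**: if the `x`-coordinate class of every rational point of `E_n` lies in
`{1, [−1], [n], [−n]} = α(E_n[2])`, then `φ_n(A_n(ℚ)) + E_n[2] = E_n(ℚ)` — translate by the `2`-torsion point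
with the same class and apply `mem_rhoSubgroup_of_sqClass_eq_one`. [cite: TianYuanZhang2017, §1, definition of ρ(n)]
[cite: SilvermanAEC2009, Prop. X.4.9] -/
theorem rhoIndex_eq_one_of_forall_inTorsionClasses {n : ℕ} (hn : n ≠ 0)
    (h : ∀ P : (congruentNumberCurve n).toAffine.Point,
      (sqClass (descentRep 0 (-(n : ℚ)) n P) = 1 ∨ sqClass (descentRep 0 (-(n : ℚ)) n P) = sqClass (-1 : ℚ) ∨ sqClass (descentRep 0 (-(n : ℚ)) n P) = sqClass (n : ℚ) ∨ sqClass (descentRep 0 (-(n : ℚ)) n P) = sqClass (-(n : ℚ)))) :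
    (rhoSubgroup n).index = 1 := by
  haveI := isElliptic_congruentNumberCurve hn
  set N : ℚ := (n : ℚ) with hN
  have hN0 : N ≠ 0 := by rw [hN]; exact_mod_cast hn
  rw [AddSubgroup.index_eq_one, eq_top_iff]
  intro P _
  -- the three `2`-torsion points, their membership and their classes
  have h0 := hsplit n
  set T0 : (congruentNumberCurve n).toAffine.Point := .some 0 _ (nonsingular_twoTorsion h0) with hT0
  set Tm : (congruentNumberCurve n).toAffine.Point := .some _ _ (nonsingular_twoTorsion h0.swap₁₂) with hTm
  set Tp : (congruentNumberCurve n).toAffine.Point := .some _ _ (nonsingular_twoTorsion h0.swap₂₃.swap₁₂) with hTp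
  have mT0 : T0 ∈ rhoSubgroup n := AddSubgroup.subset_closure (Or.inr (two_nsmul_twoTorsion h0))
  have mTm : Tm ∈ rhoSubgroup n := AddSubgroup.subset_closure (Or.inr (two_nsmul_twoTorsion h0.swap₁₂))
  have mTp : Tp ∈ rhoSubgroup n := AddSubgroup.subset_closure (Or.inr (two_nsmul_twoTorsion h0.swap₂₃.swap₁₂))
  have cT0 : twoDescentComponent _ 0 (-N) N T0 = sqClass (-1 : ℚ) := by
    rw [hT0, twoDescentComponent_some_of_eq _ rfl, show ((0:ℚ) - -N) * (0 - N) = (-1) * (N * N) by ring,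
      sqClass_mul (by norm_num) (mul_ne_zero hN0 hN0), sqClass_mul_self, mul_one]
  have cTm : twoDescentComponent _ 0 (-N) N Tm = sqClass (-N) := by
    rw [hTm, twoDescentComponent_some_of_ne _ (neg_ne_zero.mpr hN0), sub_zero]
  have cTp : twoDescentComponent _ 0 (-N) N Tp = sqClass N := by
    rw [hTp, twoDescentComponent_some_of_ne _ hN0, sub_zero]
  -- translate `P` by the torsion point with the same class
  have step : ∀ T : (congruentNumberCurve n).toAffine.Point, T ∈ rhoSubgroup n →
      twoDescentComponent _ 0 (-N) N T = twoDescentComponent _ 0 (-N) N P → P ∈ rhoSubgroup n := by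
    intro T hT hc
    have h1 : sqClass (descentRep 0 (-N) N (P + T)) = 1 := by
      rw [← twoDescentComponent_eq_sqClass, twoDescentComponent_add h0, hc, SqUnits.mul_self]
    have hPT := mem_rhoSubgroup_of_sqClass_eq_one hn (P + T) h1
    have := (rhoSubgroup n).sub_mem hPT hT
    rwa [add_sub_cancel_right] at this
  rcases h P with h | h | h | h <;> rw [← twoDescentComponent_eq_sqClass] at h
  · exact step 0 (zero_mem _) (by rw [h]; rfl)
  · exact step T0 mT0 (by rw [h, cT0])
  · exact step Tp mTp (by rw [h, cTp])
  · exact step Tm mTm (by rw [h, cTm])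

/-! ### §3. The converse direction: a witness point forces `ρ(n) ≥ 1` -/

section Witness

/-- `α(P)` (`FaulknerJames2007.alphaHom`) is the `2`-descent component for the root `0`. [folklore] -/
private theorem toMul_alphaHom {n : ℕ} (hn : n ≠ 0) (P : (congruentNumberCurve n).toAffine.Point) :
    Additive.toMul (alphaHom n hn P) = twoDescentComponent (congruentNumberCurve n).toAffine 0 (-(n : ℚ)) n P :=
  rfl

/-- **`φ_n(A_n(ℚ)) + E_n[2] ≤ α⁻¹{1, [−1], [n], [−n]}`**: the `x`-coordinate class of every element of
`rhoSubgroup n` lies in `{1, [−1], [n], [−n]}` — the `x`-coordinate of `φ_n(u, v)` is the square `(nv/u)²`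
(`2nv² = u³ + u`), a point killed by `2` is `O` or has `y = 0`, i.e. `x ∈ {0, ±n}`, and the four classes form a
subgroup (`α` is a homomorphism, `FaulknerJames2007.alphaHom`).
[cite: TianYuanZhang2017, §1, definition of ρ(n)] [cite: SilvermanAEC2009, Prop. X.4.9] -/
theorem sqClass_descentRep_of_mem_rhoSubgroup {n : ℕ} (hn : n ≠ 0)
    {P : (congruentNumberCurve n).toAffine.Point} (hP : P ∈ rhoSubgroup n) :
    sqClass (descentRep 0 (-(n : ℚ)) n P) = 1 ∨ sqClass (descentRep 0 (-(n : ℚ)) n P) = sqClass (-1 : ℚ) ∨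
      sqClass (descentRep 0 (-(n : ℚ)) n P) = sqClass (n : ℚ) ∨
      sqClass (descentRep 0 (-(n : ℚ)) n P) = sqClass (-(n : ℚ)) := by
  haveI := isElliptic_congruentNumberCurve hn
  have hn0 : (n : ℚ) ≠ 0 := Nat.cast_ne_zero.mpr hn
  -- work with `α = alphaHom` (additive) and the predicate on `Additive (ℚ^×/ℚ^{×2})`
  rw [← twoDescentComponent_eq_sqClass, ← toMul_alphaHom hn]
  refine AddSubgroup.closure_induction (p := fun Q _ => Additive.toMul (alphaHom n hn Q) = 1 ∨
      Additive.toMul (alphaHom n hn Q) = sqClass (-1 : ℚ) ∨ Additive.toMul (alphaHom n hn Q) = sqClass (n : ℚ) ∨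
      Additive.toMul (alphaHom n hn Q) = sqClass (-(n : ℚ))) ?_ ?_ ?_ ?_ hP
  · -- generators
    rintro Q (hQ | hQ)
    · -- `Q ∈ φ_n(A_n(ℚ))`
      rw [toMul_alphaHom hn]
      rcases hQ with rfl | ⟨u, v, hA, hu, h, rfl⟩
      · exact Or.inl rfl
      · have hx : (n : ℚ) * ((u + u⁻¹) / 2) = ((n : ℚ) * v / u) ^ 2 := by
          have : u + u⁻¹ = 2 * n * v ^ 2 / u ^ 2 := by
            field_simp
            linear_combination -hA
          rw [this]
          field_simp
        by_cases hx0 : (n : ℚ) * ((u + u⁻¹) / 2) = 0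
        · rw [twoDescentComponent_some_of_eq h hx0]
          right; left
          rw [show ((0:ℚ) - -(n:ℚ)) * (0 - n) = (-1) * ((n:ℚ) * n) by ring,
            sqClass_mul (by norm_num) (mul_ne_zero hn0 hn0), sqClass_mul_self, mul_one]
        · rw [twoDescentComponent_some_of_ne h hx0, sub_zero, hx]
          left
          rw [sq, sqClass_mul_self]
    · -- `2 • Q = 0`
      rw [toMul_alphaHom hn]
      rcases Q with _ | ⟨x, y, h⟩
      · exact Or.inl rfl
      · have h2 : (2 : ℕ) • (Point.some x y h : (congruentNumberCurve n).toAffine.Point) = 0 := hQ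
        rw [two_nsmul, ← eq_neg_iff_add_eq_zero, Affine.Point.neg_some, Affine.Point.some.injEq] at h2
        have hy : y = 0 := by
          have := h2.2
          rw [Affine.negY, cn_affine_a₁, cn_affine_a₃] at this
          linarith
        have hcurve := (cn_nonsingular_iff hn x y).mp h
        rw [hy] at hcurve
        have hx : x = 0 ∨ x = n ∨ x = -(n : ℚ) := by
          have : (x - -(n:ℚ)) * (x - 0) * (x - n) = 0 := by linear_combination -hcurve
          rcases mul_eq_zero.mp this with h' | h'
          · rcases mul_eq_zero.mp h' with h'' | h''
            · right; right; linear_combination h''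
            · left; linear_combination h''
          · right; left; linear_combination h'
        rcases hx with hx | hx | hx
        · rw [twoDescentComponent_some_of_eq h hx]
          right; left
          rw [show ((0:ℚ) - -(n:ℚ)) * (0 - n) = (-1) * ((n:ℚ) * n) by ring,
            sqClass_mul (by norm_num) (mul_ne_zero hn0 hn0), sqClass_mul_self, mul_one]
        · rw [twoDescentComponent_some_of_ne h (by rw [hx]; exact hn0), hx, sub_zero]
          right; right; left; rfl
        · rw [twoDescentComponent_some_of_ne h (by rw [hx]; exact neg_ne_zero.mpr hn0), hx, sub_zero]
          right; right; right; rfl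
  · -- `0`
    exact Or.inl (by rw [_root_.map_zero]; rfl)
  · -- sums: the four classes are closed under multiplication
    intro Q R _ _ hQ hR
    rw [_root_.map_add, toMul_add]
    have e1 : sqClass (n : ℚ) * sqClass (-1 : ℚ) = sqClass (-(n : ℚ)) := by
      rw [← sqClass_mul hn0 (by norm_num), mul_neg_one]
    have e2 : sqClass (-1 : ℚ) * sqClass (-(n : ℚ)) = sqClass (n : ℚ) := by
      rw [← e1, mul_comm (sqClass (n : ℚ)), ← mul_assoc, SqUnits.mul_self, one_mul]
    rcases hQ with h1 | h1 | h1 | h1 <;> rcases hR with h2 | h2 | h2 | h2 <;> rw [h1, h2]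
    · exact Or.inl (one_mul 1)
    · exact Or.inr (Or.inl (one_mul _))
    · exact Or.inr (Or.inr (Or.inl (one_mul _)))
    · exact Or.inr (Or.inr (Or.inr (one_mul _)))
    · exact Or.inr (Or.inl (mul_one _))
    · exact Or.inl (SqUnits.mul_self _)
    · exact Or.inr (Or.inr (Or.inr (by rw [mul_comm, e1])))
    · exact Or.inr (Or.inr (Or.inl e2))
    · exact Or.inr (Or.inr (Or.inl (mul_one _)))
    · exact Or.inr (Or.inr (Or.inr e1))
    · exact Or.inl (SqUnits.mul_self _)
    · exact Or.inr (Or.inl (by rw [← e1, ← mul_assoc, SqUnits.mul_self, one_mul]))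
    · exact Or.inr (Or.inr (Or.inr (mul_one _)))
    · exact Or.inr (Or.inr (Or.inl (by rw [mul_comm, e2])))
    · exact Or.inr (Or.inl (by rw [← e1, mul_comm (sqClass (n : ℚ)) (sqClass (-1:ℚ)), mul_assoc,
        SqUnits.mul_self, mul_one]))
    · exact Or.inl (SqUnits.mul_self _)
  · -- negatives: every class is its own inverse
    intro Q _ hQ
    rwa [_root_.map_neg, toMul_neg, sqUnits_inv_eq_self]

/-- **A witness point forces `ρ(n) ≥ 1`.** If some rational point `P ∈ E_n(ℚ)` has
`x(P) ∉ {1, −1, n, −n}·ℚ^{×2}` (for `P = (0,0)` read `x` as `−n²`), then `φ_n(A_n(ℚ)) + E_n[2] ≠ E_n(ℚ)`, i.e.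
`ρ(n) ≠ 0`. With `rank E_n(ℚ) = 1` and `s(n) = 1` this is the converse of `rhoIndex_eq_one_of_ker_pair_odd`
(take `P` a generator). [cite: TianYuanZhang2017, §1, definition of ρ(n)] [cite: SilvermanAEC2009, Prop. X.4.9] -/
theorem rhoIndex_ne_one_of_witness {n : ℕ} (hn : n ≠ 0) (P : (congruentNumberCurve n).toAffine.Point)
    (hP : ¬ (sqClass (descentRep 0 (-(n : ℚ)) n P) = 1 ∨ sqClass (descentRep 0 (-(n : ℚ)) n P) = sqClass (-1 : ℚ) ∨
      sqClass (descentRep 0 (-(n : ℚ)) n P) = sqClass (n : ℚ) ∨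
      sqClass (descentRep 0 (-(n : ℚ)) n P) = sqClass (-(n : ℚ)))) :
    (rhoSubgroup n).index ≠ 1 := by
  rw [Ne, AddSubgroup.index_eq_one]
  intro htop
  exact hP (sqClass_descentRep_of_mem_rhoSubgroup hn (by rw [htop]; exact AddSubgroup.mem_top P))

/-- `(−3, 36) ∈ E_21(ℚ)`: `36² = 1296 = (−3)³ − 441·(−3)`. [folklore] -/
private theorem nonsingular_twentyOne : (congruentNumberCurve 21).toAffine.Nonsingular (-3) 36 :=
  (cn_nonsingular_iff (by norm_num) _ _).mpr (by norm_num)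

/-- A rational square has even `p`-adic valuation. [folklore] -/
private theorem even_padicValRat_sq (p : ℕ) [Fact p.Prime] {u : ℚ} (hu : u ≠ 0) :
    Even (padicValRat p (u ^ 2)) := by
  rw [sq, padicValRat.mul hu hu]; exact Even.add_self _

/-- **`ρ(21) ≠ 0`**: the point `(−3, 36) ∈ E_21(ℚ)` has `x = −3 ∉ {1, −1, 21, −21}·ℚ^{×2}` (`−3 < 0`;
`3` and `63 = −3·(−21)` have odd valuation at `3` resp. `7`). Since `s(21) = 1` (Monsky's `4 × 4` matrix) and
`Σ₁(21) = g(21)` is odd, `E_21` belongs to the U⁺ family of the cell `bsd-print-cf2` but NOT to the flag-free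
`TYZρ` family (`ρ = 0` clause), and the typed Theorem 1.4 (`2^{ρ+1} ∣ 𝓛 → genus sums even`) does not decide the
parity of `𝓛(21)`. [cite: TianYuanZhang2017, §1, definition of ρ(n); Thm. 1.2] -/
theorem rhoIndex_ne_one_twentyOne : (rhoSubgroup 21).index ≠ 1 := by
  haveI : Fact (Nat.Prime 3) := ⟨Nat.prime_three⟩
  haveI : Fact (Nat.Prime 7) := ⟨by norm_num⟩
  refine rhoIndex_ne_one_of_witness (by norm_num) (.some (-3) 36 nonsingular_twentyOne) ?_
  rw [descentRep_some_of_ne _ (by norm_num), show (-3 : ℚ) - 0 = -3 by ring]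
  have h3 : (-3 : ℚ) ≠ 0 := by norm_num
  -- `[−3] = [u]` iff `−3u` is a square
  have crit : ∀ u : ℚ, u ≠ 0 → sqClass (-3 : ℚ) = sqClass u → ∃ r : ℚ, -3 * u = r ^ 2 := by
    intro u hu h
    have h1 : sqClass (-3 * u) = 1 := by rw [sqClass_mul h3 hu, h, SqUnits.mul_self]
    exact (sqClass_eq_one_iff (mul_ne_zero h3 hu)).mp h1
  have one_eq : (1 : SqUnits ℚ) = sqClass (1 : ℚ) := by rw [← mul_one (1:ℚ), sqClass_mul_self]
  rintro (h | h | h | h)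
  · obtain ⟨r, hr⟩ := crit 1 one_ne_zero (by rw [h, one_eq])
    nlinarith [sq_nonneg r]
  · obtain ⟨r, hr⟩ := crit (-1) (by norm_num) h
    have hr0 : r ≠ 0 := by rintro rfl; norm_num at hr
    have := even_padicValRat_sq 3 hr0
    rw [← hr, show (-3 : ℚ) * -1 = 3 by ring, show (3:ℚ) = ((3:ℕ):ℚ) by norm_num, padicValRat.of_nat,
      padicValNat_self] at this
    exact absurd this (by decide)
  · obtain ⟨r, hr⟩ := crit 21 (by norm_num) h
    nlinarith [sq_nonneg r]
  · obtain ⟨r, hr⟩ := crit (-21) (by norm_num) h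
    have hr0 : r ≠ 0 := by rintro rfl; norm_num at hr
    have := even_padicValRat_sq 7 hr0
    rw [← hr, show (-3 : ℚ) * -(21:ℚ) = 9 * 7 by ring, padicValRat.mul (by norm_num) (by norm_num),
      show (9:ℚ) = ((9:ℕ):ℚ) by norm_num, show (7:ℚ) = ((7:ℕ):ℚ) by norm_num, padicValRat.of_nat,
      padicValRat.of_nat, padicValNat_self,
      padicValNat.eq_zero_of_not_dvd (p := 7) (n := 9) (by norm_num)] at this
    exact absurd this (by decide)

end Witness

end RhoMonskyKernel

end Literature.NumberTheory.EllipticCurves.TianYuanZhang2017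

end
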